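import Summits.ResolutionOfSingularities.ResolutionOfSingularities.Theorems.FrobeniusClosingSteerVisitLawDelta
import HarnessLib

/-!
# hS1b PROOF MAP v1.0 — the INTERMEDIATE WORDS (signatures only; for the tri word-check before any hand proves them)

res-L0-w41-strat-2 g4 (author/objector of hS1b per RULING 264(d)/265(b)). OURS; candidates, not facts; nothing here is a
statement of [Hironaka2017]. Zero sorries: every word is a `def … : Prop`. Files of the map: A1 `…ReducedOrderPolyCores.lean`
(W-PC6a, W-PC6b), A2 `…ReducedOrderVisitLaw.lean` (W-TOI, W-VM, W-ESC), B `…EventuallyConstantReducedOrder.lean` (assembly).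
-/

set_option linter.dupNamespace false

open IsLocalRing

namespace Summit.ResolutionOfSingularities.ResolutionOfSingularities.Theorems.SwitchingDichotomy.ReducedOrder

open Literature.AlgebraicGeometry.Resolution
open Summit.ResolutionOfSingularities.ResolutionOfSingularities.Theorems.SwitchingDichotomy.Words

/-! NAMESPACE NOTE for the hands: the hS1b word's hygiene binders `h0`/`h1` speak `SigmaTopLegality.IsSingPrime` (as `…VisitLawDelta`), while the
run's `IsSigmaTopCentre` (hence the point-step contradiction) speaks `Words.IsPermissibleCentre` / `Words.IsSingPrime` (as `…PointStepNoSurfaceCleaning`);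
the two vocabularies have byte-identical bodies (`…Words06SteeredVocab` l.75–95 vs `…SigmaTopLegality` l.73–89) and bridge by `Iff.rfl`. Below: hypotheses
in the `SigmaTopLegality` currency, conclusions in the `Words` currency. -/

/-- **W-PC6a · PolyCleanBound** (A1, step (e6a)): over a PERFECT field of characteristic `2`, a NON-SQUARE polynomial `g` of total
degree `≤ n` cannot be cleaned into `𝔮^(n+1)` at any maximal ideal `𝔮`: `g − γ² ∉ 𝔪^(n+1)` in `k[T]_𝔮` for every `γ`.
(Some `pderiv i g ≠ 0` since `k` is perfect; `pderiv` kills squares; `𝔮^n` is `𝔮`-primary; Taylor bound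
`algebraMap_mvPolynomial_not_mem_maximalIdeal_pow` on `pderiv i g`, of degree `≤ n − 1`.) OURS. (folklore) -/
def PolyCleanBound : Prop :=
  ∀ (k : Type) [Field k] [CharP k 2] [PerfectField k] (σ : Type) [Fintype σ] [DecidableEq σ]
    (𝔮 : Ideal (MvPolynomial σ k)) [𝔮.IsMaximal]
    (S : Type) [CommRing S] [Algebra (MvPolynomial σ k) S] [IsLocalization.AtPrime S 𝔮] [IsLocalRing S]
    (g : MvPolynomial σ k) (n : ℕ), (∀ q : MvPolynomial σ k, g ≠ q ^ 2) → g.totalDegree ≤ n →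
    ∀ γ : S, algebraMap (MvPolynomial σ k) S g - γ ^ 2 ∉ maximalIdeal S ^ (n + 1)

/-- **W-PC6b · PolyCleanBoundBelow** (A1, step (e6b)): `n` EVEN, `g = ℓ·g₁` NON-SQUARE with `deg ℓ ≤ 1`, `ℓ ∉ 𝔮` (the odd divisor
ESCAPES the point `𝔮`) and `deg g₁ ≤ n − 1`: then `g` cannot even be cleaned into `𝔮^n` — one better than W-PC6a. (Cross-derivatives
`ℓ_i ∂_k g + ℓ_k ∂_i g = ℓ·(…)` of degree `≤ n − 2` vanish by the Taylor bound; in the affine coordinate `u := ℓ`, `g₁ ∈ k[u, T′², T″²]`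
and `∂_u g = Σ_{a even} u^a q_a` is a square polynomial of degree `≤ n − 1` lying in `𝔮^(n−1)`, `n − 1` odd, hence zero — a non-zero
square has even degree; then `g = u²·□` is a square: contradiction.) OURS. (folklore) -/
def PolyCleanBoundBelow : Prop :=
  ∀ (k : Type) [Field k] [CharP k 2] [PerfectField k] (σ : Type) [Fintype σ] [DecidableEq σ]
    (𝔮 : Ideal (MvPolynomial σ k)) [𝔮.IsMaximal]
    (S : Type) [CommRing S] [Algebra (MvPolynomial σ k) S] [IsLocalization.AtPrime S 𝔮] [IsLocalRing S]
    (ℓ g₁ : MvPolynomial σ k) (n : ℕ), Even n → ℓ.totalDegree ≤ 1 → ℓ ∉ 𝔮 → g₁.totalDegree + 1 ≤ n →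
    (∀ q : MvPolynomial σ k, ℓ * g₁ ≠ q ^ 2) →
    ∀ γ : S, algebraMap (MvPolynomial σ k) S (ℓ * g₁) - γ ^ 2 ∉ maximalIdeal S ^ n

variable (K : Type) [Field K]

/-- **W-TOI · TwoOddIllegal** (A2, step (g); member level, characteristic `2`): on a regular local member `R ⊆ K` of dimension `4`,
two ODD divisors `a`, `b` through the centre which are part of a regular system of parameters (`a` prime, `a ∤ b`, `(a, b)` prime
with regular quotient), i.e. `f ≡ □ (mod a)` and `f ≡ □ (mod b)`, make `(a, b)` a σ_top-PERMISSIBLE centre as soon as no prime of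
height `0` or `1` is singular (N4 hygiene) — so σ_top does NOT take the point step there. (`SigmaTopLegality.sub_sq_mem_span_mul_span_pair`
⇒ `f − ga² = a·G`, `G ∈ (a, b)`, `G ∉ (a)` by `VisitLawDelta.clord_le_one_of_noSingularHeightOne`; then
`SigmaTopLegalityOddDivisor.oddDivisor_fork` at the minimal prime `(a, b) ⊇ (a, G)`.) OURS. (folklore) -/
def TwoOddIllegal : Prop :=
  ∀ [CharP K 2] (R : Subring K) [IsRegularLocalRing R], ringKrullDim R = (4 : ℕ) →
    ∀ (f a b ga gb : R), Prime a → ¬ a ∣ b → a ∈ maximalIdeal R → a ∉ maximalIdeal R ^ 2 →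
    ∀ hP : (Ideal.span ({a, b} : Set R)).IsPrime, IsRegularLocalRing (R ⧸ Ideal.span ({a, b} : Set R)) →
    f - ga ^ 2 ∈ Ideal.span {a} → f - gb ^ 2 ∈ Ideal.span {b} →
    (∀ (Q : Ideal R) [Q.IsPrime], Q.height = 0 → ¬ SigmaTopLegality.IsSingPrime R 2 f Q) →
    (∀ (Q : Ideal R) [Q.IsPrime], Q.height = 1 → ¬ SigmaTopLegality.IsSingPrime R 2 f Q) →
    Words.IsPermissibleCentre R 2 f (Ideal.span ({a, b} : Set R))

/-- **W-VM · ReducedOrderVisitLaw** (A2, steps (a)–(f): THE HEART; run level, shape of `VisitLawDelta.visitLaw₂_of_run` + hygiene at `j′`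
+ perfect residue field at `j`): along a late visit pair the cleaned order grows by at most one and tri-1ʼs REDUCED ORDER
`d := ν − #odd` does NOT increase (Hauser–Perlega 2019 §3 «an increase needs two lost odd components», in the typed currency where an
odd divisor is ANY regular parameter of odd clord). OURS. (ref. CossartPiltant2008, proof of Prop. 4.2, (10)–(11)) (folklore) -/
def ReducedOrderVisitLaw : Prop :=
  ∀ [CharP K 2] (O : ValuationSubring K) (R : ℕ → Subring K) (P : (i : ℕ) → Ideal (R i)) (t : K) (s : ℕ → K),
    IsSteeredRun O R P t 2 s → SubringDominates (R 0) O.toSubring →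
    (∀ i, IsRegularLocalRing (R i)) → (∀ i, ringKrullDim (R i) = (4 : ℕ)) →
    (∀ i, ∃ _ : IsLocalRing (R i), PerfectField (ResidueField (R i))) →
    ∀ (j j' : ℕ) (x : K), IsVisitPair R P j j' →
      ((∃ h : x ∈ R j, (⟨x, h⟩ : R j) ∈ P j) ∧ x ≠ 0 ∧ ∀ y : R j, y ∈ P j → O.valuation (y : K) ≤ O.valuation x) →
      (∀ k, j < k → k < j' → ∃ hx : x ∈ R k, P k = Ideal.span {(⟨x, hx⟩ : R k)}) →
      (∀ (hs' : s j' ^ 2 ∈ R j') (Q : Ideal (R j')) [Q.IsPrime], Q.height = 0 →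
        ¬ SigmaTopLegality.IsSingPrime (R j') 2 ⟨s j' ^ 2, hs'⟩ Q) →
      (∀ (hs' : s j' ^ 2 ∈ R j') (Q : Ideal (R j')) [Q.IsPrime], Q.height = 1 →
        ¬ SigmaTopLegality.IsSingPrime (R j') 2 ⟨s j' ^ 2, hs'⟩ Q) →
      ∀ (ν d : ℕ), 2 ≤ ν → HasCleanedOrderAt R s 2 j ν → HasReducedOrderAt R s 2 j d →
        ∃ ν' d' : ℕ, HasCleanedOrderAt R s 2 j' ν' ∧ HasReducedOrderAt R s 2 j' d' ∧ ν' ≤ ν + 1 ∧ d' ≤ d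

/-- **W-ESC · EscapeLaw** (A2, for step (M4); run level): for three consecutive late visits `j < j′ < j″` with ODD cleaned orders at
`j` and at `j′`, the exceptional parameters of `j` and `j′` have THE SAME value — otherwise `x/x′ ∈ 𝔪_{j″}` and `x′` are two odd divisors
at the point step `j″` (W-TOI). OURS. (folklore) -/
def EscapeLaw : Prop :=
  ∀ [CharP K 2] (O : ValuationSubring K) (R : ℕ → Subring K) (P : (i : ℕ) → Ideal (R i)) (t : K) (s : ℕ → K),
    IsSteeredRun O R P t 2 s → SubringDominates (R 0) O.toSubring →
    (∀ i, IsRegularLocalRing (R i)) → (∀ i, ringKrullDim (R i) = (4 : ℕ)) →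
    (∀ i, ∃ _ : IsLocalRing (R i), PerfectField (ResidueField (R i))) →
    ∀ (j j' j'' : ℕ) (x x' : K), IsVisitPair R P j j' → IsVisitPair R P j' j'' →
      ((∃ h : x ∈ R j, (⟨x, h⟩ : R j) ∈ P j) ∧ x ≠ 0 ∧ ∀ y : R j, y ∈ P j → O.valuation (y : K) ≤ O.valuation x) →
      ((∃ h : x' ∈ R j', (⟨x', h⟩ : R j') ∈ P j') ∧ x' ≠ 0 ∧
        ∀ y : R j', y ∈ P j' → O.valuation (y : K) ≤ O.valuation x') →
      (∀ k, j < k → k < j' → ∃ hx : x ∈ R k, P k = Ideal.span {(⟨x, hx⟩ : R k)}) →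
      (∀ k, j' < k → k < j'' → ∃ hx : x' ∈ R k, P k = Ideal.span {(⟨x', hx⟩ : R k)}) →
      (∀ i ∈ ({j', j''} : Set ℕ), ∀ (hs' : s i ^ 2 ∈ R i) (Q : Ideal (R i)) [Q.IsPrime], Q.height = 0 →
        ¬ SigmaTopLegality.IsSingPrime (R i) 2 ⟨s i ^ 2, hs'⟩ Q) →
      (∀ i ∈ ({j', j''} : Set ℕ), ∀ (hs' : s i ^ 2 ∈ R i) (Q : Ideal (R i)) [Q.IsPrime], Q.height = 1 →
        ¬ SigmaTopLegality.IsSingPrime (R i) 2 ⟨s i ^ 2, hs'⟩ Q) →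
      ∀ (ν ν' : ℕ), Odd ν → Odd ν' → 2 ≤ ν → 2 ≤ ν' → HasCleanedOrderAt R s 2 j ν → HasCleanedOrderAt R s 2 j' ν' →
        O.valuation x = O.valuation x'

end Summit.ResolutionOfSingularities.ResolutionOfSingularities.Theorems.SwitchingDichotomy.ReducedOrder
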